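import Mathlib
import HarnessLib
import Summits.Ventures.LatticeQCDFlow.Scaling.Acceptance

/-!
# LatticeQCDFlow / Scaling — the SHARP ESS floor of the overlap: `1 − TV(p, q) ≥ min(ESS, 1/2)`,
# and with the tree's `χ²` bound the exact envelope `max(min(ESS, 1/2), 1 − ½√(1/ESS − 1))`

HONEST FRAMING: exact (Metropolis-corrected) sampling algorithms for lattice gauge theory;
figures of merit are autocorrelation/cost numbers at stated couplings and volumes; no
continuum-physics claim.

Venture `LatticeQCDFlow` (cell pub-lqcd), topic `Scaling`; FANOUT row 3 (`s0-u1-a`, S0-B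
implementation A, GEN-8).  NEW WORK of the cell (one Cauchy–Schwarz on the set where the target
exceeds the model, and a one-line polynomial identity), not a published result; NO definition is
introduced.  Companion of row 3's `Scaling/AcceptanceEssEightNinths` (`acc ≥ (8/9)·ESS`): the
same question for the OVERLAP `m = Σ_x min(p_x, q_x) = 1 − ‖p − q‖_TV` (the i.i.d. resampling /
maximal-coupling acceptance, `Scaling/Bhattacharyya.sum_min_eq_one_sub_tvDist`), whose floors in
the tree are row 2's measure-theoretic `overlap_ge_of_weightMoment` (`m ≥ κ/(1 + κ)`) and the
`χ²` bound `(2·TV)² ≤ 1/ESS − 1` (`Scaling/Acceptance.sq_two_mul_tvDist_le`).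

## Setting (finite `X`; target `p ≥ 0`, model `q > 0`, both normalised; `κ = ESS = essFrac p q`,
## `1/κ = Σ_x p_x²/q_x`; `m = Σ_x min(p_x, q_x)`)

* **`min_essFrac_half_le_sum_min`** — `min(κ, 1/2) ≤ m` (the model's normalisation is not even
  used).  Proof: if `m < 1/2`, let `U = {q < p}`,
  `y = q(U)`, `x = p(Uᶜ)`, so `m = x + y` and `p(U) = 1 − x`; Cauchy–Schwarz on `U` gives
  `1/κ ≥ Σ_U p²/q ≥ (1 − x)²/y`, and `(x + y)(1 − x)² − y = (m − y)(1 − m(2 − m + y)) ≥ 0` because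
  `y ≤ m ≤ 1/2`; hence `m/κ ≥ 1`;
* **`essFrac_le_one_sub_tvDist_of_le_half`** — `κ ≤ 1/2 ⇒ κ ≤ 1 − ‖p − q‖_TV`;
* `div_one_add_le_min_half` — `κ/(1 + κ) ≤ min(κ, 1/2)` on `[0, 1]`: the new floor dominates
  `κ/(1 + κ)` everywhere;
* **`overlap_envelope`** — `max(min(κ, 1/2), 1 − ½√(1/κ − 1)) ≤ 1 − ‖p − q‖_TV` (the second entry
  is the tree's `χ²` bound, better exactly when `κ > 1/2`);
* SHARPNESS, both pieces, on two points: `hitOrMiss_sum_min_eq_essFrac` — target `δ_hit`, model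
  hitting with probability `α`: `m = κ = α` (so `min(κ, 1/2) ≤ m` is attained for every `κ ≤ 1/2`,
  and `m = κ` CAN hold above `1/2`); `symmetricPair_overlap` — `p = (½(1 − s), ½(1 + s))`,
  `q = (½, ½)`: `κ = 1/(1 + s²)`, `m = 1 − s/2 = 1 − ½√(1/κ − 1)` (the `χ²` piece is attained for
  every `κ ∈ (1/2, 1]`), and **`exists_sum_min_lt_essFrac`** — at `s = 1/2`: `κ = 4/5 > m = 3/4`, so
  `m ≥ κ` FAILS above `1/2`: the envelope is exactly two-piece.

NOT CLAIMED: the measure-theoretic version (row 2's setting); anything about acceptance of the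
CHAIN (that is `Scaling/AcceptanceEssEightNinths`); any number of ours; nothing re-scored.
-/

namespace Summit.Ventures.LatticeQCDFlow.Theory2

open Finset
open Literature.Probability.MarkovChains
open Summit.Ventures.LatticeQCDFlow.Exactness

variable {X : Type*} [Fintype X]

/-- **`min(ESS, 1/2) ≤ Σ_x min(p_x, q_x)`** for every normalised pair (`p ≥ 0`, `q > 0`).
[folklore] -/
theorem min_essFrac_half_le_sum_min {p q : X → ℝ} (hp : ∀ x, 0 ≤ p x) (hq : ∀ x, 0 < q x)
    (hp1 : ∑ x, p x = 1) :
    min (essFrac p q) (1 / 2) ≤ ∑ x, min (p x) (q x) := by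
  classical
  set m := ∑ x, min (p x) (q x) with hm
  rcases le_or_gt (1 / 2 : ℝ) m with hhalf | hhalf
  · exact (min_le_right _ _).trans hhalf
  -- `m < 1/2`: show `essFrac ≤ m`
  refine (min_le_left _ _).trans ?_
  set U : Finset X := univ.filter (fun x => q x < p x) with hU
  set y : ℝ := ∑ x ∈ U, q x with hy
  set xL : ℝ := ∑ x ∈ univ.filter (fun x => ¬ (q x < p x)), p x with hxL
  -- `m = xL + y`, `p(U) = 1 − xL`
  have hmin_split : m = xL + y := by
    rw [hm, ← sum_filter_add_sum_filter_not univ (fun x => q x < p x), hy, hxL, add_comm]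
    congr 1
    · exact sum_congr rfl fun x hx => min_eq_left (not_lt.mp (mem_filter.mp hx).2)
    · exact sum_congr rfl fun x hx => min_eq_right (mem_filter.mp hx).2.le
  have hpU : ∑ x ∈ U, p x = 1 - xL := by
    have h := sum_filter_add_sum_filter_not univ (fun x => q x < p x) p
    rw [hp1] at h
    rw [hU, hxL]
    linarith
  -- the second weight moment `B = Σ p²/q = 1/ESS`
  set B : ℝ := ∑ x, p x * weight p q x with hB
  have hEss : essFrac p q = B⁻¹ := essFrac_eq_inv hq hp1
  have hBU : ∑ x ∈ U, p x * weight p q x ≤ B :=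
    sum_le_sum_of_subset_of_nonneg (filter_subset _ _)
      (fun x _ _ => mul_nonneg (hp x) (div_nonneg (hp x) (hq x).le))
  -- Cauchy–Schwarz on `U`: `p(U)² ≤ q(U) · Σ_U p²/q`
  have hCS : (∑ x ∈ U, p x) ^ 2 ≤ y * ∑ x ∈ U, p x * weight p q x := by
    have h := Finset.sum_mul_sq_le_sq_mul_sq U (fun x => Real.sqrt (q x))
      (fun x => p x / Real.sqrt (q x))
    have hs : ∀ x, 0 < Real.sqrt (q x) := fun x => Real.sqrt_pos.2 (hq x)
    have e1 : ∀ x, Real.sqrt (q x) * (p x / Real.sqrt (q x)) = p x := fun x => by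
      rw [mul_div_assoc', mul_div_cancel_left₀ _ (hs x).ne']
    have e2 : ∀ x, Real.sqrt (q x) ^ 2 = q x := fun x => Real.sq_sqrt (hq x).le
    have e3 : ∀ x, (p x / Real.sqrt (q x)) ^ 2 = p x * weight p q x := fun x => by
      rw [div_pow, e2, mul_weight_eq_sq_div]
    simp_rw [e1, e2, e3] at h
    exact h
  rw [hpU] at hCS
  -- `y > 0` (otherwise `p ≤ q` everywhere, `m = 1`)
  have hy0 : 0 ≤ y := sum_nonneg fun x _ => (hq x).le
  have hxL0 : 0 ≤ xL := sum_nonneg fun x _ => hp x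
  have hypos : 0 < y := by
    rcases hy0.lt_or_eq with h | h
    · exact h
    · exfalso
      have h0 : (1 - xL) ^ 2 ≤ 0 := by rw [← h] at hCS; simpa using hCS
      have : xL = 1 := by nlinarith
      rw [hmin_split, this, ← h] at hhalf
      norm_num at hhalf
  have hBpos : 0 < B := by
    have : 0 < essFrac p q := essFrac_pos hq hp1
    rw [hEss] at this
    exact inv_pos.mp this
  -- `m · B ≥ (xL + y)(1 − xL)²/y ≥ 1`
  have hkey : y ≤ (xL + y) * (1 - xL) ^ 2 := by
    have hym : y ≤ xL + y := by linarith
    have hid : (xL + y) * (1 - xL) ^ 2 - y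
        = ((xL + y) - y) * (1 - (xL + y) * (2 - (xL + y) + y)) := by ring
    have h2 : 0 ≤ 1 - (xL + y) * (2 - (xL + y) + y) := by
      rw [← hmin_split]; nlinarith
    nlinarith [mul_nonneg hxL0 h2]
  have hmB : 1 ≤ m * B := by
    rw [hmin_split]
    have h1 : (1 - xL) ^ 2 ≤ y * B := hCS.trans (mul_le_mul_of_nonneg_left hBU hy0)
    -- `(xL + y) · B · y ≥ (xL + y)(1 − xL)² ≥ y`
    have h2 : y * 1 ≤ y * ((xL + y) * B) := by nlinarith [mul_nonneg hxL0 hy0]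
    exact le_of_mul_le_mul_left h2 hypos
  rw [hEss]
  calc B⁻¹ = B⁻¹ * 1 := (mul_one _).symm
    _ ≤ B⁻¹ * (m * B) := mul_le_mul_of_nonneg_left hmB (inv_pos.2 hBpos).le
    _ = m := by field_simp

/-- **`ESS ≤ 1/2 ⇒ ESS ≤ 1 − ‖p − q‖_TV`**: in the low-ESS regime the overlap is at least the ESS
fraction (sharp: the hit-or-miss pair has equality). [folklore] -/
theorem essFrac_le_one_sub_tvDist_of_le_half {p q : X → ℝ} (hp : ∀ x, 0 ≤ p x) (hq : ∀ x, 0 < q x)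
    (hp1 : ∑ x, p x = 1) (hq1 : ∑ x, q x = 1) (h : essFrac p q ≤ 1 / 2) :
    essFrac p q ≤ 1 - tvDist p q := by
  rw [← sum_min_eq_one_sub_tvDist hp1 hq1, ← min_eq_left h]
  exact min_essFrac_half_le_sum_min hp hq hp1

/-- `κ/(1 + κ) ≤ min(κ, 1/2)` for `κ ∈ [0, 1]`: the new floor dominates the `κ/(1+κ)` floor
everywhere. [folklore] -/
theorem div_one_add_le_min_half {κ : ℝ} (h0 : 0 ≤ κ) (h1 : κ ≤ 1) :
    κ / (1 + κ) ≤ min κ (1 / 2) := by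
  have hd : 0 < 1 + κ := by linarith
  refine le_min ?_ ?_
  · rw [div_le_iff₀ hd]; nlinarith
  · rw [div_le_iff₀ hd]; linarith

/-- **The two-piece envelope**: `max(min(ESS, 1/2), 1 − ½√(1/ESS − 1)) ≤ 1 − ‖p − q‖_TV` (the second
entry is the tree's `χ²` bound `(2·TV)² ≤ 1/ESS − 1`). [folklore] -/
theorem overlap_envelope {p q : X → ℝ} (hp : ∀ x, 0 ≤ p x) (hq : ∀ x, 0 < q x)
    (hp1 : ∑ x, p x = 1) (hq1 : ∑ x, q x = 1) :
    max (min (essFrac p q) (1 / 2)) (1 - Real.sqrt ((essFrac p q)⁻¹ - 1) / 2)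
      ≤ 1 - tvDist p q := by
  classical
  refine max_le ?_ ?_
  · rw [← sum_min_eq_one_sub_tvDist hp1 hq1]
    exact min_essFrac_half_le_sum_min hp hq hp1
  · have h := sq_two_mul_tvDist_le hq hp1 hq1
    have ht : 0 ≤ 2 * tvDist p q := by have := tvDist_nonneg p q; linarith
    have h2 : 2 * tvDist p q ≤ Real.sqrt ((essFrac p q)⁻¹ - 1) := by
      rw [← Real.sqrt_sq ht]
      exact Real.sqrt_le_sqrt h
    linarith

/-! ### Sharpness on two points -/

/-- **Hit-or-miss: `m = κ = α`.**  Target `p = ![0, 1]`, model `q = ![1 − α, α]` (`0 < α < 1`):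
`Σ min(p, q) = α = essFrac p q` — the floor `min(κ, 1/2) ≤ m` is attained for every `κ ≤ 1/2`
(and `m = κ` can hold above `1/2`). [folklore] -/
theorem hitOrMiss_sum_min_eq_essFrac {α : ℝ} (hα0 : 0 < α) (hα1 : α < 1) :
    (∑ x, min (![(0 : ℝ), 1] x) (![1 - α, α] x)) = α ∧ essFrac ![(0 : ℝ), 1] ![1 - α, α] = α := by
  have hα : α ≠ 0 := hα0.ne'
  constructor
  · simp only [Fin.sum_univ_two, Matrix.cons_val_zero, Matrix.cons_val_one]
    rw [min_eq_left (by linarith), min_eq_right hα1.le]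
    ring
  · unfold essFrac weight
    simp only [Fin.sum_univ_two, Matrix.cons_val_zero, Matrix.cons_val_one]
    field_simp
    ring

/-- **The symmetric pair: `κ = 1/(1 + s²)`, `m = 1 − s/2`.**  Target `p = ![(1 − s)/2, (1 + s)/2]`,
model `q = ![1/2, 1/2]` (`0 ≤ s ≤ 1`): the `χ²` piece `1 − ½√(1/κ − 1)` of the envelope is attained
(`1/κ − 1 = s²`). [folklore] -/
theorem symmetricPair_overlap {s : ℝ} (hs0 : 0 ≤ s) (hs1 : s ≤ 1) :
    (∑ x, min (![(1 - s) / 2, (1 + s) / 2] x) (![(1 : ℝ) / 2, 1 / 2] x)) = 1 - s / 2 ∧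
    (essFrac ![(1 - s) / 2, (1 + s) / 2] ![(1 : ℝ) / 2, 1 / 2])⁻¹ - 1 = s ^ 2 := by
  have _ := hs1
  constructor
  · simp only [Fin.sum_univ_two, Matrix.cons_val_zero, Matrix.cons_val_one]
    rw [min_eq_left (by linarith), min_eq_right (by linarith)]
    ring
  · unfold essFrac weight
    simp only [Fin.sum_univ_two, Matrix.cons_val_zero, Matrix.cons_val_one]
    have h1 : (1 - s) ^ 2 + (1 + s) ^ 2 ≠ 0 := by positivity
    field_simp
    ring

/-- **`m ≥ κ` fails above `1/2`**: the symmetric pair at `s = 1/2` has `κ = 4/5 > 1/2` and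
`m = 3/4 < κ` — the envelope is genuinely two-piece. [folklore] -/
theorem exists_sum_min_lt_essFrac :
    ∃ p q : Fin 2 → ℝ, (∀ x, 0 < p x) ∧ (∀ x, 0 < q x) ∧ ∑ x, p x = 1 ∧ ∑ x, q x = 1 ∧
      1 / 2 < essFrac p q ∧ ∑ x, min (p x) (q x) < essFrac p q := by
  obtain ⟨hm, hk⟩ := symmetricPair_overlap (s := 1 / 2) (by norm_num) (by norm_num)
  have hE : essFrac ![(1 - 1 / 2) / 2, (1 + 1 / 2) / 2] ![(1 : ℝ) / 2, 1 / 2] = 4 / 5 := by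
    have h54 : (essFrac ![(1 - 1 / 2) / 2, (1 + 1 / 2) / 2] ![(1 : ℝ) / 2, 1 / 2])⁻¹ = 5 / 4 := by
      linarith
    have := congrArg (·⁻¹) h54
    simpa using this
  refine ⟨![(1 - 1 / 2) / 2, (1 + 1 / 2) / 2], ![(1 : ℝ) / 2, 1 / 2], ?_, ?_, ?_, ?_, ?_, ?_⟩
  · intro x; fin_cases x <;> simp <;> norm_num
  · intro x; fin_cases x <;> simp
  · simp [Fin.sum_univ_two]; norm_num
  · simp [Fin.sum_univ_two]; norm_num
  · rw [hE]; norm_num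
  · rw [hm, hE]; norm_num

end Summit.Ventures.LatticeQCDFlow.Theory2
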